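import Summits.ResolutionOfSingularities.ResolutionOfSingularities.Theorems.FrobeniusClosingSteerSwitchingAssembly
import Summits.ResolutionOfSingularities.ResolutionOfSingularities.Theorems.FrobeniusClosingSteerRsopMonomialStep
import Literature.AlgebraicGeometry.Resolution.QuadraticTransformsRegular
import Literature.AlgebraicGeometry.Resolution.ArithmeticalThreefolds
import HarnessLib

/-!
# Crux `Steer` (stmt-ResolutionOfSingularities-16345), chain W4.1, NSCᴹ line — **HULL VOCABULARY**
# (point sequences, Shannon extension, Noetherian hull, near / far elements, monomial × unit)

OURS (campaign `res-hironaka`, rung L ★L-G4, slot W4.1; seat res-type-028 on res-L0-w41-plan-1's UNCLAIMED-STUB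
LIST 2026-08-27T08:41:57Z item **U2 «NSCᴹ-VOCAB HOIST»** / res-plan-2 IDLE POOL DEAL #2 08:42:41Z; NOT a statement of the
manuscript under review [claim: Hironaka2017, status: under-review]; AI-produced, weaker than expert review).

This is a DEFINITION file (no stub is closed here).  It hoists into the tree the data vocabulary of
res-L0-w41-idea-2's kernel-checked sketch `L/res-L0-w41-idea-2/Sketch-idea-2f.lean` (sha16 64403cb98dc5de30,
§1 / §G5 / §H6) for the registered residual `stub_nonSwitchingCoreM : NonSwitchingCoreM` of the line of record
`Cruxes/Steer/Lines/switching_dichotomy.lean` (holder res-L0-w41-lead-1), so that the line's support pieces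
(`FarPthPowerNearReduction p`, `ResonanceAlternative p`, … — res-L0-w41-plan-1's U3/U4) can be stated and landed as
Theses-free helper theorems over TREE names instead of thirty-line unfoldings:

* §1 `MonomialUnitAt S g` — `g ∈ K` is a monomial in a part of a regular system of parameters of the local
  subring `S ⊆ K` times a unit of `S` (HLOST Prop. 4.4's value-monomial form); `ToroidalAt p S g` and `GenAt S p t s'`
  (VERBATIM re-declarations of the skeleton's defs — this file imports no `Cruxes`/`Theses` module; bridges are
  `Iff.rfl`, res-L0-w41-plan-1 CUT 08:48:07Z / RULING 26a); `ResonantAt p S g`; the `p`-strip dichotomy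
  `toroidalAt_or_pthPower_of_monomialUnitAt` and `monomialUnitAt_of_toroidalAt`.
* §2 `IsPointSequenceAlong O A₀ R` (the sequence of quadratic transforms of `(A₀)_{𝔪_O ∩ A₀}` along `O`),
  `shannonExt R = ⋃ᵢ Rᵢ` and its bookkeeping (monotone, members regular and dominated by `O`).
* §3 `IsHullParameter O R x`, `IsNear R x a` / `IsFar R x a` (units / non-units of the Noetherian hull
  `S[1/x]`, HLOST Thm. 4.1 / Prop. 4.4; in terms of HOT's function `e` (arXiv:1509.07545 Def. 5.1, Lemma 5.2 (4)):
  near ⟺ `e(a) = 0`, far ⟺ `e(a) > 0`), `noethHull R x` (as a set), `hullRing R x = S[x⁻¹]` (as a subring),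
  `IsFarRegular R x z`, `IsRegularCentreTowerAlong O T`.
* The PROVED pieces — `nearMonomialReach_holds` (type = the body of the sketch's `NearMonomialReach`; HLOST Prop. 4.4 made
  elementary by the tree's `exists_monomial_along` ∘ `stub_rsopMonomialStep` and `exists_monomial_of_mul_eq`),
  `farRegularExit`, `MonomialUnitAt.along`, `T = S[1/x]` both ways and «near ⟺ unit of `T`» — live in the companion
  def-free file `FrobeniusClosingSteerHullNearReach.lean` (the gate's 400-line rule for files with proofs).

Every `def` is a literal copy of the sketch's text (same binder names and order), so the sketch / the skeleton adopt
them BY NAME definitionally.  No `instance`, no notation, no `sorry`.  Sources of the mathematics: W. Heinzer,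
K. A. Loper, B. Olberding, H. Schoutens, M. Toeniskoetter [HeinzerEtAl2015] §1, Lemma 2.7, Prop. 3.8, Thm. 4.1,
Prop. 4.4; W. Heinzer, B. Olberding, M. Toeniskoetter [HeinzerOlberdingToeniskoetter2017] = arXiv:1509.07545 («HOT»;
locators here refer to that text — the bib key's eprint/doi fields point at Heinzer–Kim–Toeniskoetter arXiv:1512.03848,
a bib erratum for the owner of `references.bib`): Def. 5.1 (the function `e`), Lemma 5.2; D. Shannon [Shannon1973];
S. D. Cutkosky [Cutkosky2014] §2.2.  ERRATUM rev 2 (2026-08-27, res-type-028 g10; DOCSTRINGS ONLY, every declaration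
body byte-identical to rev 1 p517308 5659320dd892b782; lane notes res-L1-ref-b2 ERRATUM #11, res-L1-ref-a1 desk #294):
the rev-1 tags «HOT Def. 1.1» on `IsFar` / `IsFarRegular` were dangling (HOT Def. 1.1, p.3, defines the Shannon
extension; read on the page) — corrected to Lemma 5.2 (4) «`e(a) = 0` iff `a ∈ T^×`» / Def. 5.1; the words far / near /
far-regular themselves are OURS (res-L0-w41-idea-2's Sketch-idea-2f), HOT/HLOST are cited for the underlying notions.
-/

noncomputable section

-- `Summit.<S>.<S>.…` duplicates the summit name by design (single-problem summit).
set_option linter.dupNamespace false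
set_option autoImplicit false

namespace Summit.ResolutionOfSingularities.ResolutionOfSingularities.Theorems.SwitchingDichotomy.Hull

open IsLocalRing
open Literature.AlgebraicGeometry.Resolution

variable {k K : Type} [Field k] [Field K] [Algebra k K]

/-! ## §1 Monomial × unit, resonance, the `p`-strip dichotomy -/

/-- **`MonomialUnitAt S g`**: `g ∈ K` is a MONOMIAL in a part `z` of a regular system of parameters of the local
subring `S ⊆ K` times a UNIT of `S` — the line's `ToroidalAt` WITHOUT the clause «some exponent prime to `p`»
(value-monomial form; HLOST Prop. 4.4's «`(aR_n)^{R_{n+i}} = R_{n+i}`» for one element).  Literal copy of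
res-L0-w41-idea-2's `Idea2g4.MonomialUnitAt` (Sketch-idea-2f l.110). OURS. [cite: HeinzerEtAl2015, Prop. 4.4] -/
def MonomialUnitAt (S : Subring K) [IsLocalRing S] (g : K) : Prop :=
  ∃ (s : ℕ) (z : Fin s → S), IsRsopPart z ∧ ∃ (m : Fin s → ℕ) (u : S), IsUnit u ∧
    g = (∏ l, ((z l : S) : K) ^ m l) * (u : K)

/-- **`ToroidalAt p S g`** (the line's exit shape E2): `g` is a monomial in a part of a regular system of parameters of
`S` with SOME exponent prime to `p`, times a unit.  VERBATIM copy of the skeleton's `ToroidalAt` (line of record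
`Cruxes/Steer/Lines/switching_dichotomy.lean` l.896 = holder's r26 l.821 = Sketch-idea-2f l.53; same body, so the bridge
to the skeleton's copy is `Iff.rfl` — re-declared here because a `Theorems` file cannot import the sorry-bearing
skeleton, res-L0-w41-plan-1 CUT 08:48:07Z / RULING 26a). OURS. [folklore] -/
def ToroidalAt (p : ℕ) (S : Subring K) [IsLocalRing S] (g : K) : Prop :=
  ∃ (s : ℕ) (z : Fin s → S), IsRsopPart z ∧ ∃ (m : Fin s → ℕ), (∃ l, ¬ p ∣ m l) ∧
    ∃ u : S, IsUnit u ∧ g = (∏ l, ((z l : S) : K) ^ m l) * (u : K)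

/-- **`GenAt S p t s'`**: `s'` is a GENERATOR of the `α_p`-torsor of `t` over `S` — `s' ^ p ∈ S` and `t ∈ S[s']`.
VERBATIM copy of the skeleton's `GenAt` (`Cruxes/Steer/Lines/switching_dichotomy.lean` l.742 = r26 l.667 = Sketch-idea-2f
l.320; bridge `Iff.rfl`; re-declared per res-L0-w41-plan-1 CUT 08:48:07Z). OURS. [folklore] -/
def GenAt (S : Subring K) (p : ℕ) (t s' : K) : Prop :=
  s' ^ p ∈ S ∧ t ∈ Subring.closure (insert s' (S : Set K))

/-- A generator's `p`-th power and the base generate a ring containing `t`; in particular `t ∈ S[s']` gives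
`t ^ p ∈ S[s']` trivially — recorded as the one-line sanity link between the two clauses. OURS. [folklore] -/
theorem GenAt.pow_mem_closure {S : Subring K} {p : ℕ} {t s' : K} (h : GenAt S p t s') :
    t ^ p ∈ Subring.closure (insert s' (S : Set K)) :=
  Subring.pow_mem _ h.2 p

/-- **`ResonantAt p S g`** (the obstruction to the budgeted exits): EVERY monomial × unit presentation of `g` in `S`
has all exponents divisible by `p`, and every CLEANING of its unit by a `p`-th power that lands in `𝔪_S` lands in
`𝔪_S²` (the cleaned unit radicand `u − c^p` is never a regular parameter).  Literal copy of `Idea2g4.ResonantAt`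
(Sketch-idea-2f l.137). OURS. [folklore] -/
def ResonantAt (p : ℕ) (S : Subring K) [IsLocalRing S] (g : K) : Prop :=
  ∀ (s : ℕ) (z : Fin s → S), IsRsopPart z → ∀ (m : Fin s → ℕ) (u : S), IsUnit u →
    g = (∏ l, ((z l : S) : K) ^ m l) * (u : K) →
      (∀ l, p ∣ m l) ∧ ∀ c : S, u - c ^ p ∈ maximalIdeal S → u - c ^ p ∈ (maximalIdeal S) ^ 2

/-- A unit of `S` is monomial × unit (empty monomial). OURS. [folklore] -/
theorem monomialUnitAt_of_isUnit (S : Subring K) [IsRegularLocalRing S] (u : S) (hu : IsUnit u) :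
    MonomialUnitAt S (u : K) := by
  classical
  obtain ⟨x, hx⟩ := exists_regularSystemOfParameters (R := S)
  refine ⟨0, x ∘ Fin.elim0, isRsopPart_comp_of_rsop rfl x hx Fin.elim0 (fun i => i.elim0), Fin.elim0, u, hu, ?_⟩
  rw [Fin.prod_univ_zero, one_mul]

/-- A member of a part of a regular system of parameters is monomial × unit (exponent vector `δⱼ`, unit `1`).
OURS. [folklore] -/
theorem monomialUnitAt_of_isRsopPart (S : Subring K) [IsLocalRing S] {s : ℕ} (z : Fin s → S)
    (hz : IsRsopPart z) (j : Fin s) : MonomialUnitAt S ((z j : S) : K) := by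
  classical
  refine ⟨s, z, hz, fun l => if l = j then 1 else 0, 1, isUnit_one, ?_⟩
  rw [Finset.prod_eq_single j (fun l _ hl => by simp [hl]) (fun h => absurd (Finset.mem_univ j) h)]
  simp

/-- **`p`-STRIP DICHOTOMY** (kernel-checked exponent arithmetic): a monomial × unit is either TOROIDAL with an
exponent prime to `p` (the line's exit E2) or a `p`-th POWER of an element of `S` times a unit (unit-radicand rebirth
`(t₂/m₀)^p = u`).  Literal copy of `Idea2g4.toroidalAt_or_pthPower_of_monomialUnitAt` (Sketch-idea-2f l.117). OURS.
[folklore] -/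
theorem toroidalAt_or_pthPower_of_monomialUnitAt (p : ℕ) (S : Subring K) [IsLocalRing S] (g : K)
    (hg : MonomialUnitAt S g) :
    ToroidalAt p S g ∨ ∃ (m₀ : K) (u : S), m₀ ∈ S ∧ IsUnit u ∧ g = m₀ ^ p * (u : K) := by
  obtain ⟨s, z, hz, m, u, hu, rfl⟩ := hg
  by_cases h : ∃ l, ¬ p ∣ m l
  · exact Or.inl ⟨s, z, hz, m, h, u, hu, rfl⟩
  · push Not at h
    refine Or.inr ⟨∏ l, ((z l : S) : K) ^ (m l / p), u, ?_, hu, ?_⟩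
    · exact Subring.prod_mem _ fun l _ => Subring.pow_mem _ (z l).2 _
    · rw [← Finset.prod_pow]
      congr 1
      refine Finset.prod_congr rfl fun l _ => ?_
      rw [← pow_mul, Nat.div_mul_cancel (h l)]

/-- A toroidal radicand is in particular monomial × unit.  Literal copy of `Idea2g4.monomialUnitAt_of_toroidalAt`
(Sketch-idea-2f l.896). OURS. [folklore] -/
theorem monomialUnitAt_of_toroidalAt (p : ℕ) (S : Subring K) [IsLocalRing S] (g : K) (h : ToroidalAt p S g) :
    MonomialUnitAt S g := by
  obtain ⟨s, z, hz, m, -, u, hu, hg⟩ := h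
  exact ⟨s, z, hz, m, u, hu, hg⟩

/-- Sanity (the pieces of the NSCᴹ budget line are disjoint cases): under resonance of EVERY presentation, a toroidal
presentation with an exponent prime to `p` is impossible.  Literal copy of `Idea2g4.not_toroidalAt_of_resonantAt`
(Sketch-idea-2f l.304). OURS. [folklore] -/
theorem not_toroidalAt_of_resonantAt (p : ℕ) (S : Subring K) [IsLocalRing S] (g : K) (h : ResonantAt p S g) :
    ¬ ToroidalAt p S g := by
  rintro ⟨s, z, hz, m, ⟨l, hl⟩, u, hu, hg⟩
  exact hl ((h s z hz m u hu hg).1 l)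

/-! ## §2 Point sequences along `O` and the Shannon extension -/

/-- **`IsPointSequenceAlong O A₀ R`**: `R 0 ⊆ R 1 ⊆ ⋯` is THE point sequence along `O` — the sequence of quadratic
transforms along the valuation ring `O` (`IsQuadraticTransformAlong`) starting at the local ring of `A₀` at the
centre of `O`.  Literal copy of `Idea2g4.IsPointSequenceAlong` (Sketch-idea-2f l.574). OURS.
[cite: HeinzerEtAl2015, §1 (Setting)] [cite: Cutkosky2014, §2.2] -/
def IsPointSequenceAlong (O : ValuationSubring K) (A₀ : Subalgebra k K) (R : ℕ → Subring K) : Prop :=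
  R 0 = locAtCentre A₀.toSubring O ∧ ∀ i, IsQuadraticTransformAlong O (R i) (R (i + 1))

/-- **The SHANNON EXTENSION `S = ⋃ᵢ Rᵢ`** of a sequence of subrings (as a subring: the supremum).  Literal copy of
`Idea2g4.shannonExt` (Sketch-idea-2f l.578). OURS. [cite: HeinzerEtAl2015, §1] [cite: Shannon1973, §4] -/
def shannonExt (R : ℕ → Subring K) : Subring K := ⨆ i, R i

/-- A member of the sequence lies in the Shannon extension. OURS. [folklore] -/
theorem le_shannonExt (R : ℕ → Subring K) (i : ℕ) : R i ≤ shannonExt R :=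
  le_iSup R i

/-- For a MONOTONE sequence the Shannon extension is the union: membership means membership in some member.
OURS. [folklore] -/
theorem mem_shannonExt_iff_of_monotone {R : ℕ → Subring K} (hmono : Monotone R) (a : K) :
    a ∈ shannonExt R ↔ ∃ i, a ∈ R i :=
  Subring.mem_iSup_of_directed hmono.directed_le

/-- For a monotone sequence, two elements of the Shannon extension lie in a common member. OURS. [folklore] -/
theorem exists_mem_mem_of_monotone {R : ℕ → Subring K} (hmono : Monotone R) {a b : K}
    (ha : a ∈ shannonExt R) (hb : b ∈ shannonExt R) : ∃ i, a ∈ R i ∧ b ∈ R i := by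
  obtain ⟨i, hi⟩ := (mem_shannonExt_iff_of_monotone hmono a).mp ha
  obtain ⟨j, hj⟩ := (mem_shannonExt_iff_of_monotone hmono b).mp hb
  exact ⟨i + j, hmono (Nat.le_add_right i j) hi, hmono (Nat.le_add_left j i) hj⟩

/-- The Shannon extension of a sequence of subrings of `O` lies in `O`. OURS. [folklore] -/
theorem shannonExt_le_of_forall_le {R : ℕ → Subring K} {B : Subring K} (h : ∀ i, R i ≤ B) :
    shannonExt R ≤ B :=
  iSup_le h

namespace IsPointSequenceAlong

variable {O : ValuationSubring K} {A₀ : Subalgebra k K} {R : ℕ → Subring K}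

/-- The point sequence is monotone. OURS. [folklore] -/
theorem monotone (hR : IsPointSequenceAlong O A₀ R) : Monotone R :=
  sequence_monotone hR.2

/-- Membership in the Shannon extension of a point sequence = membership in some member. OURS. [folklore] -/
theorem mem_shannonExt_iff (hR : IsPointSequenceAlong O A₀ R) (a : K) : a ∈ shannonExt R ↔ ∃ i, a ∈ R i :=
  mem_shannonExt_iff_of_monotone hR.monotone a

/-- Every member of a point sequence is a local ring. OURS. [folklore] -/
theorem isLocalRing (hR : IsPointSequenceAlong O A₀ R) (i : ℕ) : IsLocalRing (R i) := by
  obtain ⟨h, -⟩ := hR.2 i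
  exact h

/-- If the base lies in `O`, every member of the point sequence is dominated by `O` (its maximal ideal is the
centre of `O`) and dominates `R 0`. OURS. [folklore] -/
theorem subringDominates (hR : IsPointSequenceAlong O A₀ R) (h₀ : A₀.toSubring ≤ O.toSubring) (i : ℕ) :
    SubringDominates (R i) O.toSubring ∧ SubringDominates (R 0) (R i) := by
  have hdom₀ : SubringDominates (R 0) O.toSubring := by
    rw [hR.1]
    exact subringDominates_locAtCentre h₀
  exact sequence_dominates hdom₀ hR.2 i

/-- Every member of the point sequence lies in `O` (base in `O`). OURS. [folklore] -/
theorem le_valuationSubring (hR : IsPointSequenceAlong O A₀ R) (h₀ : A₀.toSubring ≤ O.toSubring) (i : ℕ) :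
    R i ≤ O.toSubring :=
  (hR.subringDominates h₀ i).1.1

/-- The Shannon extension of the point sequence lies in `O` (base in `O`). OURS. [folklore] -/
theorem shannonExt_le (hR : IsPointSequenceAlong O A₀ R) (h₀ : A₀.toSubring ≤ O.toSubring) :
    shannonExt R ≤ O.toSubring :=
  shannonExt_le_of_forall_le (hR.le_valuationSubring h₀)

/-- If the base `A₀ ⊆ O` is regular at the centre of `O`, every member of the point sequence is a regular local
ring (Abhyankar). OURS. [folklore] -/
theorem isRegularLocalRing (hR : IsPointSequenceAlong O A₀ R) (h₀ : A₀.toSubring ≤ O.toSubring)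
    (hreg : IsRegularLocalRing (Localization.AtPrime
      (Ideal.comap (Subring.inclusion h₀) (IsLocalRing.maximalIdeal O)))) (i : ℕ) :
    IsRegularLocalRing (R i) := by
  have hreg₀ : IsRegularLocalRing (R 0) := by
    rw [hR.1]
    exact (isRegularLocalRing_locAtCentre_iff h₀).mpr hreg
  exact isRegularLocalRing_sequence hreg₀ hR.2 i

end IsPointSequenceAlong

/-! ## §3 Hull parameter, near / far, the Noetherian hull -/

/-- **The NOETHERIAN HULL as a set**: `S[1/x] = {s / x^m}` (HLOST Thm. 4.1 (1): for a hull parameter `x` this is the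
intersection of all DVRs of `K` properly containing `S`, a regular Noetherian UFD, independent of `x`).  Literal copy
of `Idea2g4.noethHull` (Sketch-idea-2f l.582); the subring form is `hullRing` below. OURS. [cite: HeinzerEtAl2015, Thm. 4.1] -/
def noethHull (R : ℕ → Subring K) (x : K) : Set K :=
  {y | ∃ (m : ℕ) (s : K), s ∈ shannonExt R ∧ y = s / x ^ m}

/-- **`x` is a HULL PARAMETER**: a one-element part of a regular system of parameters of some member `Rᵢ` (hence
prime there, of positive value) such that `xS` is primary for the maximal ideal `N = {a ∈ S | v(a) > 0}` of `S`
(every element of `S` of positive value has a power divisible by `x` in `S`) — exists by HLOST Prop. 3.8 (the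
parameter of `Rᵢ` generating `𝔪ᵢR_{i+1}`, `i ≫ 0`).  Literal copy of `Idea2g4.IsHullParameter` (Sketch-idea-2f
l.588). OURS. [cite: HeinzerEtAl2015, Prop. 3.8] -/
def IsHullParameter (O : ValuationSubring K) (R : ℕ → Subring K) (x : K) : Prop :=
  (∃ (i : ℕ) (_ : IsLocalRing (R i)) (z : Fin 1 → R i), IsRsopPart z ∧ ((z 0 : R i) : K) = x) ∧
    ∀ a ∈ shannonExt R, O.valuation a < 1 → ∃ m : ℕ, a ^ m / x ∈ shannonExt R

/-- **NEAR element** of the Shannon extension: a UNIT of the Noetherian hull `S[1/x]`, i.e. a nonzero `a ∈ S`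
dividing a power of the hull parameter inside `S` (`a · s = x^m`, `s ∈ S`; HLOST Prop. 4.4: the transform of `aRᵢ`
becomes trivial at some member).  Literal copy of `Idea2g4.IsNear` (Sketch-idea-2f l.594). OURS.
[cite: HeinzerEtAl2015, Prop. 4.4] -/
def IsNear (R : ℕ → Subring K) (x a : K) : Prop :=
  a ∈ shannonExt R ∧ a ≠ 0 ∧ ∃ (m : ℕ) (s : K), s ∈ shannonExt R ∧ a * s = x ^ m

/-- **FAR element** of the Shannon extension: a nonzero NON-unit of the Noetherian hull `T = S[1/x]` (equivalently it
lies in a height-one prime `P = ⋃ 𝔭ᵢ` of `S`, a persistent divisor of the point sequence; in HOT's language —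
arXiv:1509.07545 Def. 5.1 / Lemma 5.2 (4) «for nonzero `a ∈ S`, `e(a) = 0` iff `a ∈ T^×`» — far ⟺ `e(a) > 0`; far
elements exist iff `T` is not a field).  ERRATUM rev 2: rev 1's gloss «HOT Def. 1.1: far elements exist iff `S ⊊ T`» was a
dangling tag (HOT Def. 1.1 defines the Shannon extension) and is withdrawn; body unchanged.  Literal copy of
`Idea2g4.IsFar` (Sketch-idea-2f l.600). OURS. [cite: HeinzerEtAl2015, Prop. 4.4]
[cite: HeinzerOlberdingToeniskoetter2017, Lem. 5.2] -/
def IsFar (R : ℕ → Subring K) (x a : K) : Prop :=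
  a ∈ shannonExt R ∧ a ≠ 0 ∧ ¬ ∃ (m : ℕ) (s : K), s ∈ shannonExt R ∧ a * s = x ^ m

/-- Near / far is a genuine dichotomy on `S ∖ {0}` (definitional).  Literal copy of `Idea2g4.isNear_or_isFar`.
OURS. [folklore] -/
theorem isNear_or_isFar (R : ℕ → Subring K) (x a : K) (ha : a ∈ shannonExt R) (h0 : a ≠ 0) :
    IsNear R x a ∨ IsFar R x a := by
  by_cases h : ∃ (m : ℕ) (s : K), s ∈ shannonExt R ∧ a * s = x ^ m
  · exact Or.inl ⟨ha, h0, h⟩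
  · exact Or.inr ⟨ha, h0, h⟩

/-- Near and far exclude each other.  Literal copy of `Idea2g4.not_isFar_of_isNear`. OURS. [folklore] -/
theorem not_isFar_of_isNear (R : ℕ → Subring K) (x a : K) (h : IsNear R x a) : ¬ IsFar R x a :=
  fun hf => hf.2.2 h.2.2

/-- A far element is not near. OURS. [folklore] -/
theorem not_isNear_of_isFar (R : ℕ → Subring K) (x a : K) (h : IsFar R x a) : ¬ IsNear R x a :=
  fun hn => h.2.2 hn.2.2

/-- A near element is a unit of the hull: its inverse lies in `S[1/x]` (for `x ≠ 0`).  Literal copy of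
`Idea2g4.inv_mem_noethHull_of_isNear`. OURS. [folklore] -/
theorem inv_mem_noethHull_of_isNear (R : ℕ → Subring K) (x a : K) (hx : x ≠ 0) (h : IsNear R x a) :
    a⁻¹ ∈ noethHull R x := by
  obtain ⟨-, h0, m, s, hs, hmul⟩ := h
  refine ⟨m, s, hs, ?_⟩
  rw [eq_div_iff (pow_ne_zero m hx), ← hmul, ← mul_assoc, inv_mul_cancel₀ h0, one_mul]

/-- The first clause of `IsHullParameter` puts `x` in the Shannon extension. OURS. [folklore] -/
theorem IsHullParameter.mem_shannonExt {O : ValuationSubring K} {R : ℕ → Subring K} {x : K}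
    (hx : IsHullParameter O R x) : x ∈ shannonExt R := by
  obtain ⟨⟨i, _, z, -, hzx⟩, -⟩ := hx
  rw [← hzx]
  exact le_shannonExt R i (z 0).2

/-- A hull parameter is nonzero (it is a regular parameter of a member, hence a prime element of a domain).
OURS. [folklore] -/
theorem IsHullParameter.ne_zero {O : ValuationSubring K} {R : ℕ → Subring K} {x : K}
    (hx : IsHullParameter O R x) : x ≠ 0 := by
  obtain ⟨⟨i, _, z, hz, hzx⟩, -⟩ := hx
  rw [← hzx]
  intro h
  exact hz.ne_zero 0 (Subtype.ext h)

/-- Powers of the hull parameter are near (for `x ∈ S`, `x ≠ 0`): `x^m · 1 = x^m`. OURS. [folklore] -/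
theorem isNear_pow {R : ℕ → Subring K} {x : K} (hx : x ∈ shannonExt R) (hx0 : x ≠ 0) (m : ℕ) :
    IsNear R x (x ^ m) :=
  ⟨Subring.pow_mem _ hx m, pow_ne_zero m hx0, m, 1, Subring.one_mem _, mul_one _⟩

/-- `1` is near. OURS. [folklore] -/
theorem isNear_one {R : ℕ → Subring K} {x : K} (hx : x ∈ shannonExt R) (hx0 : x ≠ 0) : IsNear R x 1 := by
  simpa using isNear_pow hx hx0 0

/-- Near elements are closed under multiplication. OURS. [folklore] -/
theorem IsNear.mul {R : ℕ → Subring K} {x a b : K} (ha : IsNear R x a) (hb : IsNear R x b) :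
    IsNear R x (a * b) := by
  obtain ⟨haS, ha0, m, s, hs, hms⟩ := ha
  obtain ⟨hbS, hb0, n, s', hs', hns⟩ := hb
  refine ⟨Subring.mul_mem _ haS hbS, mul_ne_zero ha0 hb0, m + n, s * s', Subring.mul_mem _ hs hs', ?_⟩
  rw [pow_add, ← hms, ← hns]
  ring

/-- A divisor (inside `S`) of a near element is near: `a · c = b` with `b` near and `c ∈ S`. OURS. [folklore] -/
theorem IsNear.of_mul_eq {R : ℕ → Subring K} {x a b c : K} (hb : IsNear R x b) (ha : a ∈ shannonExt R)
    (hc : c ∈ shannonExt R) (h : a * c = b) : IsNear R x a := by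
  obtain ⟨-, hb0, m, s, hs, hms⟩ := hb
  refine ⟨ha, fun h0 => hb0 (by rw [← h, h0, zero_mul]), m, c * s, Subring.mul_mem _ hc hs, ?_⟩
  rw [← mul_assoc, h, hms]

/-- **The NOETHERIAN HULL as a subring of `K`**: `T = S[1/x]` for a hull parameter `x` (HLOST Thm. 4.1: a
localization of `Rᵢ` for `i ≫ 0`, a regular Noetherian UFD).  Literal copy of `Idea2g4.hullRing` (Sketch-idea-2f
l.814). OURS. [cite: HeinzerEtAl2015, Thm. 4.1] -/
def hullRing (R : ℕ → Subring K) (x : K) : Subring K :=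
  Subring.closure ((shannonExt R : Set K) ∪ {x⁻¹})

/-- `S ≤ T`.  Literal copy of `Idea2g4.shannonExt_le_hullRing`. OURS. [folklore] -/
theorem shannonExt_le_hullRing (R : ℕ → Subring K) (x : K) : shannonExt R ≤ hullRing R x :=
  fun _ ha => Subring.subset_closure (Set.mem_union_left _ ha)

/-- `Rᵢ ≤ T`.  Literal copy of `Idea2g4.le_hullRing`. OURS. [folklore] -/
theorem le_hullRing (R : ℕ → Subring K) (x : K) (i : ℕ) : R i ≤ hullRing R x :=
  (le_shannonExt R i).trans (shannonExt_le_hullRing R x)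

/-- `x⁻¹ ∈ T`. OURS. [folklore] -/
theorem inv_mem_hullRing (R : ℕ → Subring K) (x : K) : x⁻¹ ∈ hullRing R x :=
  Subring.subset_closure (Set.mem_union_right _ rfl)

/-- The set-hull `S[1/x]` is contained in the subring hull. OURS. [folklore] -/
theorem noethHull_subset_hullRing (R : ℕ → Subring K) (x : K) : noethHull R x ⊆ (hullRing R x : Set K) := by
  rintro y ⟨m, s, hs, rfl⟩
  rw [div_eq_mul_inv, ← inv_pow]
  exact Subring.mul_mem _ (shannonExt_le_hullRing R x hs) (Subring.pow_mem _ (inv_mem_hullRing R x) m)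

/-- **FAR-REGULAR element**: far, and from some member on equal to (near element) × (a one-element part of a regular
system of parameters of `Rᵢ`) — its strict transform is a regular parameter for ever; in HOT's language
(arXiv:1509.07545 Def. 5.1, the limit `e(a)` of the orders of the transforms of `aRₙ`; Lemma 5.2 (2)/(4)) such a `z` has
`e(z) = 1` (the near factor has `e = 0`, the regular parameter has order `1` at every later member).  ERRATUM rev 2:
rev 1's tag «HOT Def. 1.1» was dangling (Def. 1.1 defines the Shannon extension) and is replaced by Def. 5.1; the notion
«far-regular» itself is OURS (Sketch-idea-2f), not HOT's; body unchanged.  Literal copy of `Idea2g4.IsFarRegular`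
(Sketch-idea-2f l.827). OURS. [cite: HeinzerOlberdingToeniskoetter2017, Def. 5.1] -/
def IsFarRegular (R : ℕ → Subring K) (x z : K) : Prop :=
  IsFar R x z ∧ ∃ M : ℕ, ∀ i, M ≤ i → ∃ (e : K) (_ : IsLocalRing (R i)) (w : Fin 1 → R i),
    IsNear R x e ∧ IsRsopPart w ∧ z = e * ((w 0 : R i) : K)

/-- A finite tower of local blow-ups along `O` at centres with regular quotient, from `T 0` to `T N` (the shape in
which the NSCᴹ line's K-F1 `FarMonomialReach` reaches a monomial presentation).  Literal copy of
`Idea2g4.IsRegularCentreTowerAlong` (Sketch-idea-2f §T2b l.512, res-L0-w41-tri-2's repair text). OURS. [folklore] -/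
def IsRegularCentreTowerAlong (O : ValuationSubring K) {N : ℕ} (T : Fin (N + 1) → Subring K) : Prop :=
  ∀ i : Fin N, ∃ P : Ideal (T i.castSucc),
    IsRegularLocalRing ((T i.castSucc) ⧸ P) ∧ IsLocalBlowupAlong O (T i.castSucc) P (T i.succ)

/-- A prefix of a point sequence along `O` IS a tower of local blow-ups along `O` at centres with regular quotient
(the centre is the closed point; the quotient is the residue FIELD).  Literal copy of
`Idea2g4.isRegularCentreTowerAlong_of_pointSequence` (Sketch-idea-2f l.627). OURS. [folklore] -/
theorem isRegularCentreTowerAlong_of_pointSequence (O : ValuationSubring K) (A₀ : Subalgebra k K)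
    (R : ℕ → Subring K) (hR : IsPointSequenceAlong O A₀ R) (N : ℕ) :
    IsRegularCentreTowerAlong O (fun j : Fin (N + 1) => R j) := by
  intro j
  obtain ⟨hloc, hblow⟩ := hR.2 j
  refine ⟨IsLocalRing.maximalIdeal (R j), ?_, ?_⟩
  · exact isRegularLocalRing_of_isField
      ((Ideal.Quotient.maximal_ideal_iff_isField_quotient _).mp (IsLocalRing.maximalIdeal.isMaximal (R j)))
  · simpa using hblow

end Summit.ResolutionOfSingularities.ResolutionOfSingularities.Theorems.SwitchingDichotomy.Hull

end
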